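import Mathlib
import HarnessLib
import Summits.Langlands.Langlands.Theses.LiftDescend

/-!
# Birth skeleton (BC3) for crux stmt-Langlands-14091
`Summit.Langlands.Langlands.Theses.LiftDescend.PotentialAutomorphy` — line `birth`

Route `route-Langlands-LiftDescend` (rev 12; `closes (hCM : AutToGalCM) (hTR : AutToGalCMtoTR)
(hAsc : AscentAutToGal) (hPot : PotentialAutomorphy) (hDesc : DescentOfAutomorphy)
(hW2S : WeakToStrongGalToAut) : Langlands`; this crux is `hPot`, rank 3). THE CRUX (rev 11, jointly
`∃R`-pinned): for every number field `F`, if direction (A) holds over `F` for some reciprocity data `R₀`,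
then there are reciprocity data `R` over `F` with (i) (A) for `R` and (ii) every irreducible `R`-geometric
`ρ : Γ_F → GL_n(ℚ̄_ℓ)` weakly cuspidal-automorphic (a.e. Satake–Frobenius matching with an L-algebraic
cuspidal `π'` of `GL_n` over `F'`) over SOME finite Galois `F'/F` on which `ρ` STAYS IRREDUCIBLE.

Two structural facts fix the cut.
(1) `ReciprocityData.pst` is PINNED (D-0018 L2: it ignores `R` and returns Fontaine's datum), so
`IsGeometricFramed R ρ` does not depend on `R`; hence `R := R₀` settles pin (i) for free and the whole
content of the crux is (ii): POTENTIAL weak automorphy of irreducible geometric `ρ` WITH CONTROL OF THE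
FIELD `F'` (irreducibility of `ρ|_{Γ_{F'}}`). (2) Every potential-automorphy engine in print delivers its
field `F'` "linearly disjoint from any given finite extension `F^{avoid}/F`" (BLGGT Thm. 4.5.1, p. 30:
"`F'` is linearly disjoint from `F^{avoid}` over `F`"; Qian Thm. 1.4, vendored in the tree as
`Literature.NumberTheory.Automorphic.Qian2022.potentialAutomorphy_ordinary` with the clause typed
`IsField (Kav ⊗[K] K')`) — and NOT "keeping `ρ` irreducible"; the irreducibility pin of the crux is
recovered from the avoidance clause by a separate, purely Galois-theoretic lemma (monodromy-component
field). So the skeleton cuts the crux along exactly that seam: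

* `stub_potentiallyAutomorphic_avoiding` (XL, THE OPEN CORE, said openly) — given (A) over `F` for `R₀`,
  every irreducible `R₀`-geometric `ρ` becomes weakly cuspidal-automorphic over some finite Galois `F'/F`
  LINEARLY DISJOINT over `F` from any prescribed finite Galois `L/F` (`IsField (L ⊗[F] F')`, the tree's /
  Mathlib's abstract rendering of linear disjointness: `IntermediateField.LinearDisjoint.of_isField'`).
  This is the literal shape of BLGGT Thm. 4.5.1 / Cor. 4.5.3, HSBT, Qian Thm. 1.4, ACC+ — known for
  regular, polarizable / potentially diagonalizable `ρ` over CM `F` with big residual image, and for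
  regular decomposed-generic `ρ` over CM `F`; OPEN for Hodge-irregular `ρ`, for `F` neither totally real
  nor CM (no CM extension `F'` exists), and for residually small `ρ` (Calegari 2023 §12). It does NOT give
  the crux on its own (no irreducibility of `ρ|_{Γ_{F'}}`), nor the summit (no descent, no (A)).
* `stub_irreducible_restrictField_of_isField` (M/L, provable now, genuine) — MONODROMY-COMPONENT FIELD:
  for every irreducible `ρ : Γ_F → GL_n(ℚ̄_ℓ)` there is a finite Galois `L/F` such that `ρ|_{Γ_{F'}}`
  stays irreducible for every finite Galois `F'/F` linearly disjoint from `L`. Proof on paper: let `𝒢`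
  be the Zariski closure of `ρ(Γ_F)` and `L` the field cut out by `ρ⁻¹(𝒢°)` (finite Galois, as
  `[𝒢 : 𝒢°] < ∞`); for `F'` linearly disjoint from `L`, `Γ_{F'}` (an open subgroup of finite index, up
  to conjugacy = `range (absGaloisRestrict F F')`) surjects onto `Gal(L/F) = 𝒢/𝒢°`, and the Zariski
  closure of `ρ(Γ_{F'})` has finite index in `𝒢`, so contains `𝒢°`, so equals `𝒢`; a `ρ(Γ_{F'})`-stable
  subspace is `𝒢`-stable hence `Γ_F`-stable. (Finite image: `L = F̄^{ker ρ}` and `ρ(Γ_{F'}) = ρ(Γ_F)`.)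
  Folklore (used tacitly whenever potential automorphy is combined with `F^{avoid}`, e.g. BLGGT §5.3,
  Patrikis–Taylor §1); tree handles: `normal_range_absGaloisRestrict`,
  `FramedGaloisRep.toRepresentation_restrictField`, `FramedGaloisRep.isSemisimple_restrictField`
  (`Literature/NumberTheory/GaloisRepresentations/RestrictFieldSemisimple`), Mathlib
  `IntermediateField.LinearDisjoint.of_isField'`.
* `PotentialAutomorphy_of : stub 1 → stub 2 → PotentialAutomorphy` — kernel-checked, no `sorry`:
  `R := R₀` (pin (i) by hypothesis; legitimate because `pst` is pinned), then for `ρ` irreducible and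
  `R₀`-geometric take the control field `L` of STUB 2, the field `F'` of STUB 1 avoiding `L`, and read
  irreducibility of `ρ|_{Γ_{F'}}` off STUB 2. Both stubs are load-bearing.

Shape (for `ledger skeleton check` / `#h21_check_skeleton`): stubs `theorem stub_<name> : <signature> := by
sorry` (closed statements over existing declarations only); `_Goal.stub_<name> : Prop := type_of%
@stub_<name>` names each statement; the composition takes `(h₁ : _Goal.stub_potentiallyAutomorphic_avoiding)
(h₂ : _Goal.stub_irreducible_restrictField_of_isField)` and concludes the route decl BY (fully qualified)
NAME; the final `example` feeds the two stubs to it. Sorries: exactly the two stubs. Imports: the route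
module (so the verbatim sub-clauses elaborate to the route's terms) + Mathlib + HarnessLib.

Disproof used: none exists — `ledger crux ls stmt-Langlands-14091` lists no workfiles (no `Disproof.lean`,
no `Negative/` lemma, no dead line, no crux ideas) at registration time (2026-08-17); the item's evidence is
the refuters' `SummitImplies14091.lean` (`Langlands → PotentialAutomorphy`, kernel-checked: the crux is a
consequence of the summit, so no stub here may be refuted short of `¬Langlands` — stub 1 is implied by the
summit with `F' := F`, stub 2 is a theorem) and `Evidence14091.lean` (clause (ii) is never vacuous:
`trivRep` is irreducible and `R`-geometric for every `R`). `ledger negatives --problem Langlands` (3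
entries: SplitPrimeInductionDeinduction — exceptional-set mismatch in Frobenius data;
OrdinaryPrimeTransportRankinSelbergPoleCount; K3KugaSatakeDescentSerreTypeAnchor) contains nothing of the
shape of these stubs. The recorded misstatement of this very item (rev ≤ 10, `∀ R`-form refuted on paper
via a permissive prover-chosen `R.pst`) cannot recur: `pst` is pinned, and stub 1 keeps the crux's own
hypothesis `(A)_{R₀}` and the genuine `IsGeometricFramed R₀ ρ`.
-/

set_option linter.dupNamespace false

noncomputable section

namespace Summit.Langlands.Langlands.Cruxes.PotentialAutomorphy.Birth

open Summit.Langlands.Langlands.Theses.LiftDescend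
open Filter
open scoped TensorProduct

/-! ## 1. The two stubs -/

/-- **STUB 1 — potential weak automorphy AVOIDING a prescribed finite Galois extension** (the open
core of the crux, in the literal shape of the printed potential-automorphy theorems): let `F` be a number
field and `R₀` reciprocity data over `F` carrying direction (A) in every rank (the crux's own hypothesis:
it hands the prover the Galois representations `ρ_{π,ι}` attached to L-algebraic cuspidal `π` over `F`,
with local–global compatibility). Then for every `n ≥ 1`, `ℓ`, `ι : ℚ̄_ℓ ≃ ℂ` and every irreducible
`ρ : Γ_F → GL_n(ℚ̄_ℓ)` which is `R₀`-geometric (unramified a.e., de Rham above `ℓ` for the PINNED Fontaine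
datum), and for every finite Galois extension `L/F` ("`F^{avoid}`"), there are a finite Galois extension
`F'/F` LINEARLY DISJOINT from `L` over `F` (`L ⊗[F] F'` is a field) and an L-algebraic cuspidal `π'` of
`GL_n(𝔸_{F'})` Satake–Frobenius compatible with `ρ|_{Γ_{F'}}` at all but finitely many places of `F'`.
Known: `n = 1` (class field theory; de Rham characters are locally algebraic); regular Hodge–Tate weights,
polarizable and potentially diagonalizable `ρ` over CM/totally real `F` with `ρ̄|_{F(ζ_ℓ)}` irreducible
(BLGGT Thm. 4.5.1, `F'` CM, "linearly disjoint from `F^{avoid}` over `F`"); regular ordinary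
decomposed-generic enormous-image `ρ` over CM `F` (Qian Thm. 1.4, tree
`Qian2022.potentialAutomorphy_ordinary`). OPEN (why it might fail to be PROVABLE; it is implied by the
summit with `F' := F`): Hodge-irregular `ρ` (even Artin representations, abelian varieties of dimension
≥ 3), `F` of mixed signature (no CM/TR field contains `F`, so no engine's `F'` exists), residually
small / reducible `ρ` (Calegari 2023 §12); and the hypothesis (A) over `F` is NOT (A) over the `F'` where
the automorphy lifting happens.
[cite: BarnetlambEtAl2014, Thm. 4.5.1] [cite: Calegari2023, §12] -/
theorem stub_potentiallyAutomorphic_avoiding :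
    ∀ (F : Type) [Field F] [NumberField F] (R₀ : ReciprocityData F),
      (∀ n : ℕ, 0 < n →
        ∀ hcpt : Literature.NumberTheory.Automorphic.isCompact_glFiniteIntegralLevel n F,
          AutomorphicToGalois n R₀ hcpt) →
      ∀ (n : ℕ), 0 < n → ∀ (ℓ : ℕ) [Fact ℓ.Prime] (ι : PadicAlgCl ℓ ≃+* ℂ)
        (ρ : Literature.NumberTheory.GaloisRepresentations.FramedGaloisRep F (PadicAlgCl ℓ) n),
        ρ.toGaloisRep.IsIrreducible → IsGeometricFramed R₀ ρ →
        ∀ (L : Type) [Field L] [Algebra F L] [FiniteDimensional F L] [IsGalois F L],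
          ∃ (F' : Type) (_ : Field F') (_ : NumberField F') (_ : Algebra F F') (_ : IsGalois F F'),
            IsField (TensorProduct F L F') ∧
            ∃ (hcpt' : Literature.NumberTheory.Automorphic.isCompact_glFiniteIntegralLevel n F')
              (π' : Literature.NumberTheory.Automorphic.CuspidalAutomorphicRepData n F' hcpt'),
              π'.1.IsLAlgebraic ∧
                ∀ᶠ w : IsDedekindDomain.HeightOneSpectrum (NumberField.RingOfIntegers F') in cofinite,
                  SatakeFrobCompatibleAt ι π'.1 (ρ.restrictField F') w := by
  sorry

/-- **STUB 2 — the monodromy-component field controls irreducibility under restriction** (genuine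
lemma, provable now; M/L-sized in Lean): for every irreducible continuous `ρ : Γ_F → GL_n(ℚ̄_ℓ)` over a
number field `F` there is a finite Galois extension `L/F` such that for every finite Galois extension
`F'/F` (a number field) linearly disjoint from `L` over `F` (`L ⊗[F] F'` a field), the restriction
`ρ|_{Γ_{F'}} = ρ ∘ absGaloisRestrict F F'` is still irreducible. Witness: `L` = the field cut out by
`ρ⁻¹(𝒢°)`, `𝒢` the Zariski closure of the image (finite image: `L = F̄^{ker ρ}`); linear disjointness
makes `Γ_{F'}` surject onto `Gal(L/F) = 𝒢/𝒢°`, the Zariski closure of `ρ(Γ_{F'})` has finite index in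
`𝒢` hence contains `𝒢°`, so it is all of `𝒢`, and `ρ(Γ_{F'})`-stable subspaces are `Γ_F`-stable. This is
the step every "`F'` linearly disjoint from `F^{avoid}`" clause is combined with in print (BLGGT §5.3;
Patrikis–Taylor 2015 §1), isolated so that STUB 1 can be stated exactly as the engines deliver it. Tree
handles: `normal_range_absGaloisRestrict`, `FramedGaloisRep.toRepresentation_restrictField`
(`RestrictFieldSemisimple`), Mathlib `IntermediateField.LinearDisjoint.of_isField'`. [folklore] -/
theorem stub_irreducible_restrictField_of_isField :
    ∀ (F : Type) [Field F] [NumberField F] (n ℓ : ℕ) [Fact ℓ.Prime]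
      (ρ : Literature.NumberTheory.GaloisRepresentations.FramedGaloisRep F (PadicAlgCl ℓ) n),
      ρ.toGaloisRep.IsIrreducible →
        ∃ (L : Type) (_ : Field L) (_ : Algebra F L) (_ : FiniteDimensional F L) (_ : IsGalois F L),
          ∀ (F' : Type) [Field F'] [NumberField F'] [Algebra F F'] [IsGalois F F'],
            IsField (TensorProduct F L F') → (ρ.restrictField F').toGaloisRep.IsIrreducible := by
  sorry

/-! ## 2. The stub statements as named propositions (the composition's hypotheses, by name)

`_Goal` is internal on purpose: audits listing the file's declarations by short name find the `stub_*`
THEOREMS, while `#h21_check_skeleton` accepts the hypotheses of `PotentialAutomorphy_of` by the stub names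
they carry. Each `_Goal.stub_x` is `type_of% @stub_x` — no text duplicated, no `sorry` inherited. -/

namespace _Goal

/-- The statement of `stub_potentiallyAutomorphic_avoiding`, as a named `Prop` (literally its type).
[folklore] -/
def stub_potentiallyAutomorphic_avoiding : Prop :=
  type_of% @Summit.Langlands.Langlands.Cruxes.PotentialAutomorphy.Birth.stub_potentiallyAutomorphic_avoiding

/-- The statement of `stub_irreducible_restrictField_of_isField`, as a named `Prop` (literally its
type). [folklore] -/
def stub_irreducible_restrictField_of_isField : Prop :=
  type_of% @Summit.Langlands.Langlands.Cruxes.PotentialAutomorphy.Birth.stub_irreducible_restrictField_of_isField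

end _Goal

/-! ## 3. The composition (kernel-checked, no `sorry`): avoidance PA + control field → crux by name -/

/-- **`PotentialAutomorphy` from the two stubs.** Given (A) over `F` for `R₀`, take `R := R₀` (pin (i);
`IsGeometricFramed R ρ` is `R`-independent because `ReciprocityData.pst` is pinned, so nothing is lost);
for `ρ` irreducible and `R₀`-geometric, STUB 2 gives the control field `L`, STUB 1 a finite Galois `F'/F`
linearly disjoint from `L` with an L-algebraic cuspidal `π'` matching `ρ|_{Γ_{F'}}` a.e., and STUB 2 the
irreducibility of `ρ|_{Γ_{F'}}`. The hypotheses are, by name, the statements of the two stubs; the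
conclusion is the route decl `Summit.Langlands.Langlands.Theses.LiftDescend.PotentialAutomorphy`.
[folklore] -/
theorem PotentialAutomorphy_of (h₁ : _Goal.stub_potentiallyAutomorphic_avoiding)
    (h₂ : _Goal.stub_irreducible_restrictField_of_isField) :
    Summit.Langlands.Langlands.Theses.LiftDescend.PotentialAutomorphy := by
  unfold _Goal.stub_potentiallyAutomorphic_avoiding at h₁
  unfold _Goal.stub_irreducible_restrictField_of_isField at h₂
  intro F _ _ hA₀
  obtain ⟨R₀, hA⟩ := hA₀
  refine ⟨R₀, hA, ?_⟩
  intro n hn ℓ _ ι ρ hirr hgeo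
  -- the control field of `ρ` (STUB 2)
  obtain ⟨L, _, _, _, _, hL⟩ := h₂ F n ℓ ρ hirr
  -- potential weak automorphy over some `F'` avoiding `L` (STUB 1)
  obtain ⟨F', _, _, _, _, hdisj, hcpt', π', hLalg, hsat⟩ := h₁ F R₀ hA n hn ℓ ι ρ hirr hgeo L
  -- `ρ|_{Γ_{F'}}` stays irreducible (STUB 2), and `π'` matches it almost everywhere
  exact ⟨F', inferInstance, inferInstance, inferInstance, inferInstance, hL F' hdisj, hcpt', π', hLalg,
    hsat⟩

/-- By-name sanity check (an `example`, not a declaration of the file): the two stubs feed the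
composition as they stand. -/
example : Summit.Langlands.Langlands.Theses.LiftDescend.PotentialAutomorphy :=
  PotentialAutomorphy_of stub_potentiallyAutomorphic_avoiding stub_irreducible_restrictField_of_isField

end Summit.Langlands.Langlands.Cruxes.PotentialAutomorphy.Birth

end
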